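import Mathlib.Analysis.Calculus.FDeriv.Comp
import Mathlib.Analysis.Calculus.FDeriv.Prod
import Mathlib.Analysis.Calculus.FDeriv.Add
import Mathlib.Analysis.Calculus.ContDiff.Basic
import Mathlib.Analysis.InnerProductSpace.Basic
import HarnessLib

/-!
# Reading a crease band from a vertex: the two pointwise numbers

Topic `Literature/Topology/FourManifolds`; LEMMA B (crease case, zero-dimensional base) of the
first reading in the downward sweep of the smoothing of PD homeomorphisms (Munkres, Ann. of Math.
72 (1960), §5; Campbell–D'Onofrio–Vítek (2026), Lemma 3.1 read from Lemma 3.2/3.4: "`Λ` is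
bounded away from zero as soon as `w/R` is small").  A vertex `v` reads, on its shell, the output
of the crease stage of an incident edge (`CreaseStage.lean`): there the current map is
`A' ∘ g ∘ A` in the vertex's chart pair, with `A` (vertex source coordinates → crease normal
coordinates `E' × ℝ`) and `A'` (crease normal coordinates → vertex target coordinates) smooth a
priori transitions, and `g` the smoothed crease with its record (`‖g p - p‖ ≤ ε`,
`‖Dg (v,0) - (v,0)‖ ≤ ε ‖v‖`, `‖Dg (0,1) - (0,1)‖ ≤ ν`, `Dg` bounded and bounded below).  The
vertex's normal reading is `N = (A' ∘ g ∘ A)₂ - c`; the two numbers that `TubeReadableBounds`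
turns into a readable shell point are:

* `norm_fderiv_band_ge` — the fibre lower bound `(a' a_g a) ‖w‖ ≤ ‖DN(q)(0,w)‖`, the product of
  the lower bounds of the three derivatives (over a zero-dimensional base the normal reading is
  the whole map, `norm_snd_eq_norm_of_subsingleton`);
* `norm_fderiv_band_sub_le` — the Euler defect `‖DN(q)(0,y) - N q‖` is at most the defect
  `η₀ ‖y‖` of the REFERENCE reading `(A' ∘ A)₂ - c` (the upper sector model, a sector estimate)
  plus `L' ε G_g M_A ‖y‖ + M' (ε M_A ‖y‖ + ν σ) + M' ε`, where `σ` bounds the normal component of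
  `DA(q)(0,y)` — small because the band is thin (`σ ≲ W + κ r²`), which is the whole point: the
  normal column of `Dg` is NOT close to that of the identity, but it is only hit through `σ`.

Pointwise statements about values and first derivatives at one point; everything is proved, no
definitions, no named facts.

## References

* J. R. Munkres, *Obstructions to the smoothing of piecewise-differentiable homeomorphisms*, Ann.
  of Math. (2) 72 (1960), 521–554, §5. [Munkres1960]
* D. Campbell, L. D'Onofrio, T. Vítek, *Diffeomorphic approximation of piecewise affine
  homeomorphisms*, J. Geom. Anal. 36 (2026), Lemma 3.1, Lemma 3.2. [CampbellDonofrioVitek2026]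
-/

noncomputable section

open Set Function Metric Filter
open scoped Topology ContDiff

namespace Literature.Topology.FourManifolds

variable {E : Type*} [NormedAddCommGroup E] [NormedSpace ℝ E]
variable {F : Type*} [NormedAddCommGroup F] [NormedSpace ℝ F]
variable {E' : Type*} [NormedAddCommGroup E'] [NormedSpace ℝ E']

omit [NormedSpace ℝ E] [NormedSpace ℝ F] in
/-- Over a zero-dimensional base the norm of a pair is the norm of its second component.
[folklore] -/
theorem norm_snd_eq_norm_of_subsingleton [Subsingleton E] (z : E × F) : ‖z.2‖ = ‖z‖ := by
  have h1 : z.1 = 0 := Subsingleton.elim _ _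
  rw [Prod.norm_def, h1, norm_zero, max_eq_right (norm_nonneg _)]

variable {A : E × F → E' × ℝ} {A' : E' × ℝ → E × F} {g : E' × ℝ → E' × ℝ} {c : F}
  {N : E × F → F} {q : E × F}

/-- **The derivative of the band reading** `N = (A' ∘ g ∘ A)₂ - c` at `q` (chain rule).
[folklore] -/
theorem hasFDerivAt_band (hNev : N =ᶠ[𝓝 q] fun p => (A' (g (A p))).2 - c)
    (hA : DifferentiableAt ℝ A q) (hg : DifferentiableAt ℝ g (A q))
    (hA' : DifferentiableAt ℝ A' (g (A q))) :
    HasFDerivAt N ((ContinuousLinearMap.snd ℝ E F).comp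
      ((fderiv ℝ A' (g (A q))).comp ((fderiv ℝ g (A q)).comp (fderiv ℝ A q)))) q := by
  have h1 : HasFDerivAt (fun p => A' (g (A p)))
      ((fderiv ℝ A' (g (A q))).comp ((fderiv ℝ g (A q)).comp (fderiv ℝ A q))) q :=
    hA'.hasFDerivAt.comp q (hg.hasFDerivAt.comp q hA.hasFDerivAt)
  exact (h1.snd.sub_const c).congr_of_eventuallyEq hNev

/-- The fibre derivative of the band reading in a direction `(0, w)`. [folklore] -/
theorem fderiv_band_apply (hNev : N =ᶠ[𝓝 q] fun p => (A' (g (A p))).2 - c)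
    (hA : DifferentiableAt ℝ A q) (hg : DifferentiableAt ℝ g (A q))
    (hA' : DifferentiableAt ℝ A' (g (A q))) (d : E × F) :
    fderiv ℝ N q d = (fderiv ℝ A' (g (A q)) (fderiv ℝ g (A q) (fderiv ℝ A q d))).2 := by
  rw [(hasFDerivAt_band hNev hA hg hA').fderiv]
  rfl

/-- **Fibre lower bound in the band** (zero-dimensional base): the product of the lower bounds
of `DA`, `Dg`, `DA'`. [folklore] -/
theorem norm_fderiv_band_ge [Subsingleton E] (hNev : N =ᶠ[𝓝 q] fun p => (A' (g (A p))).2 - c)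
    (hA : DifferentiableAt ℝ A q) (hg : DifferentiableAt ℝ g (A q))
    (hA' : DifferentiableAt ℝ A' (g (A q))) {aA ag aA' : ℝ} (hag0 : 0 ≤ ag) (haA'0 : 0 ≤ aA')
    (haA : ∀ w : F, aA * ‖w‖ ≤ ‖fderiv ℝ A q (0, w)‖)
    (hag : ∀ z : E' × ℝ, ag * ‖z‖ ≤ ‖fderiv ℝ g (A q) z‖)
    (haA' : ∀ z : E' × ℝ, aA' * ‖z‖ ≤ ‖fderiv ℝ A' (g (A q)) z‖) (w : F) :
    aA' * ag * aA * ‖w‖ ≤ ‖fderiv ℝ N q (0, w)‖ := by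
  rw [fderiv_band_apply hNev hA hg hA', norm_snd_eq_norm_of_subsingleton]
  calc aA' * ag * aA * ‖w‖ = aA' * (ag * (aA * ‖w‖)) := by ring
    _ ≤ aA' * (ag * ‖fderiv ℝ A q (0, w)‖) := by gcongr; exact haA w
    _ ≤ aA' * ‖fderiv ℝ g (A q) (fderiv ℝ A q (0, w))‖ := by gcongr; exact hag _
    _ ≤ ‖fderiv ℝ A' (g (A q)) (fderiv ℝ g (A q) (fderiv ℝ A q (0, w)))‖ := haA' _

/-- Decomposing the action of an operator close to the identity on the face with a controlled
normal column: `‖T d - d‖ ≤ ε ‖d‖ + ν |d.2|`. [folklore] -/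
theorem norm_apply_sub_self_le {T : E' × ℝ →L[ℝ] E' × ℝ} {ε ν : ℝ} (hε0 : 0 ≤ ε)
    (hface : ∀ v : E', ‖T (v, 0) - (v, 0)‖ ≤ ε * ‖v‖) (hnormal : ‖T (0, 1) - (0, 1)‖ ≤ ν)
    (d : E' × ℝ) : ‖T d - d‖ ≤ ε * ‖d‖ + ν * |d.2| := by
  obtain ⟨v, t⟩ := d
  have hdec : ((v, t) : E' × ℝ) = (v, 0) + t • ((0 : E'), (1 : ℝ)) := by ext <;> simp
  have e : T (v, t) - (v, t) = (T (v, 0) - (v, 0)) + t • (T (0, 1) - (0, 1)) := by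
    conv_lhs => rw [hdec]
    rw [map_add, map_smul, smul_sub]
    abel
  rw [e]
  calc ‖(T (v, 0) - (v, 0)) + t • (T (0, 1) - (0, 1))‖
      ≤ ‖T (v, 0) - (v, 0)‖ + ‖t • (T (0, 1) - (0, 1))‖ := norm_add_le _ _
    _ ≤ ε * ‖v‖ + |t| * ν := by
        rw [norm_smul, Real.norm_eq_abs]
        gcongr
        exact hface v
    _ ≤ ε * ‖((v, t) : E' × ℝ)‖ + ν * |t| := by
        have : ‖v‖ ≤ ‖((v, t) : E' × ℝ)‖ := norm_fst_le ((v, t) : E' × ℝ)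
        nlinarith [abs_nonneg t, mul_le_mul_of_nonneg_left this hε0]

/-- **Euler defect in the band** (zero-dimensional base).  With `y = q.2`, `d = DA(q)(0,y)`,
the defect `‖DN(q)(0,y) - N q‖` is bounded by the defect `η₀ ‖y‖` of the reference reading
`(A' ∘ A)₂ - c` plus `L' ε G_g M_A ‖y‖ + M' (ε M_A ‖y‖ + ν σ) + M' ε`, where `‖d‖ ≤ M_A ‖y‖`,
`|d.2| ≤ σ`, `‖Dg‖ ≤ G_g`, `‖DA'(A q)‖ ≤ M'`, `‖DA'(g (A q)) - DA'(A q)‖ ≤ L' ε`,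
`‖A' (g (A q)) - A' (A q)‖ ≤ M' ε`, and `g` has the crease record at `A q`. [folklore] -/
theorem norm_fderiv_band_sub_le (hNev : N =ᶠ[𝓝 q] fun p => (A' (g (A p))).2 - c)
    (hA : DifferentiableAt ℝ A q) (hg : DifferentiableAt ℝ g (A q))
    (hA' : DifferentiableAt ℝ A' (g (A q))) {η₀ MA σ ε ν Gg MA' L' : ℝ}
    (hη₀ : ‖(fderiv ℝ A' (A q) (fderiv ℝ A q (0, q.2))).2 - ((A' (A q)).2 - c)‖ ≤ η₀ * ‖q.2‖)
    (hMA : ‖fderiv ℝ A q (0, q.2)‖ ≤ MA * ‖q.2‖) (hσ : |(fderiv ℝ A q (0, q.2)).2| ≤ σ)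
    (hε0 : 0 ≤ ε) (hν0 : 0 ≤ ν) (hL'0 : 0 ≤ L') (hMA'0 : 0 ≤ MA')
    (hgface : ∀ v : E', ‖fderiv ℝ g (A q) (v, 0) - (v, 0)‖ ≤ ε * ‖v‖)
    (hgnormal : ‖fderiv ℝ g (A q) (0, 1) - (0, 1)‖ ≤ ν) (hGg : ‖fderiv ℝ g (A q)‖ ≤ Gg)
    (hMA' : ‖fderiv ℝ A' (A q)‖ ≤ MA')
    (hL' : ‖fderiv ℝ A' (g (A q)) - fderiv ℝ A' (A q)‖ ≤ L' * ε)
    (hΔ : ‖A' (g (A q)) - A' (A q)‖ ≤ MA' * ε) :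
    ‖fderiv ℝ N q (0, q.2) - N q‖ ≤
      η₀ * ‖q.2‖ + (L' * ε * Gg * (MA * ‖q.2‖) + MA' * (ε * (MA * ‖q.2‖) + ν * σ) + MA' * ε) := by
  have hNq : N q = (A' (g (A q))).2 - c := hNev.self_of_nhds
  rw [fderiv_band_apply hNev hA hg hA', hNq]
  set d : E' × ℝ := fderiv ℝ A q (0, q.2) with hd
  set T := fderiv ℝ g (A q) with hT
  set P₁ := fderiv ℝ A' (g (A q)) with hP₁
  set P₀ := fderiv ℝ A' (A q) with hP₀
  have hd0 : 0 ≤ MA * ‖q.2‖ := (norm_nonneg _).trans hMA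
  -- the three-term decomposition
  have e : (P₁ (T d)).2 - ((A' (g (A q))).2 - c) =
      ((P₀ d).2 - ((A' (A q)).2 - c)) + ((P₁ (T d)).2 - (P₀ d).2) -
        ((A' (g (A q))).2 - (A' (A q)).2) := by abel
  rw [e]
  have t1 := hη₀
  have t3 : ‖(A' (g (A q))).2 - (A' (A q)).2‖ ≤ MA' * ε := by
    have := norm_snd_le (A' (g (A q)) - A' (A q))
    rw [Prod.snd_sub] at this
    exact this.trans hΔ
  have t2 : ‖(P₁ (T d)).2 - (P₀ d).2‖ ≤ L' * ε * Gg * (MA * ‖q.2‖) + MA' * (ε * (MA * ‖q.2‖) + ν * σ) := by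
    have h0 : ‖(P₁ (T d)).2 - (P₀ d).2‖ ≤ ‖P₁ (T d) - P₀ d‖ := by
      have := norm_snd_le (P₁ (T d) - P₀ d)
      rwa [Prod.snd_sub] at this
    have e2 : P₁ (T d) - P₀ d = (P₁ - P₀) (T d) + P₀ (T d - d) := by
      simp only [FunLike.coe_sub, Pi.sub_apply, map_sub]; abel
    have hGg0 : 0 ≤ Gg := (norm_nonneg _).trans hGg
    have hTd : ‖T d‖ ≤ Gg * (MA * ‖q.2‖) :=
      (T.le_opNorm d).trans (mul_le_mul hGg hMA (norm_nonneg _) hGg0)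
    have hTdd : ‖T d - d‖ ≤ ε * (MA * ‖q.2‖) + ν * σ := by
      have := norm_apply_sub_self_le (T := T) hε0 hgface hgnormal d
      calc ‖T d - d‖ ≤ ε * ‖d‖ + ν * |d.2| := this
        _ ≤ ε * (MA * ‖q.2‖) + ν * σ := by gcongr
    calc ‖(P₁ (T d)).2 - (P₀ d).2‖ ≤ ‖P₁ (T d) - P₀ d‖ := h0
      _ = ‖(P₁ - P₀) (T d) + P₀ (T d - d)‖ := by rw [e2]
      _ ≤ ‖(P₁ - P₀) (T d)‖ + ‖P₀ (T d - d)‖ := norm_add_le _ _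
      _ ≤ ‖P₁ - P₀‖ * ‖T d‖ + ‖P₀‖ * ‖T d - d‖ :=
          add_le_add ((P₁ - P₀).le_opNorm _) (P₀.le_opNorm _)
      _ ≤ L' * ε * (Gg * (MA * ‖q.2‖)) + MA' * (ε * (MA * ‖q.2‖) + ν * σ) := by
          gcongr
      _ = L' * ε * Gg * (MA * ‖q.2‖) + MA' * (ε * (MA * ‖q.2‖) + ν * σ) := by ring
  calc ‖((P₀ d).2 - ((A' (A q)).2 - c)) + ((P₁ (T d)).2 - (P₀ d).2) -
        ((A' (g (A q))).2 - (A' (A q)).2)‖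
      ≤ ‖(P₀ d).2 - ((A' (A q)).2 - c)‖ + ‖(P₁ (T d)).2 - (P₀ d).2‖ +
          ‖(A' (g (A q))).2 - (A' (A q)).2‖ := norm_sub_le_of_le (norm_add_le _ _) le_rfl
    _ ≤ η₀ * ‖q.2‖ + (L' * ε * Gg * (MA * ‖q.2‖) + MA' * (ε * (MA * ‖q.2‖) + ν * σ)) + MA' * ε :=
          add_le_add (add_le_add t1 t2) t3
    _ = η₀ * ‖q.2‖ + (L' * ε * Gg * (MA * ‖q.2‖) + MA' * (ε * (MA * ‖q.2‖) + ν * σ) + MA' * ε) := by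
          ring

/-- **The band defect in the form `η ‖y‖`** on the shell `‖y‖ ≥ r/4`: the constant terms are
absorbed with the factor `4/r`. [folklore] -/
theorem norm_fderiv_band_sub_le_mul (hNev : N =ᶠ[𝓝 q] fun p => (A' (g (A p))).2 - c)
    (hA : DifferentiableAt ℝ A q) (hg : DifferentiableAt ℝ g (A q))
    (hA' : DifferentiableAt ℝ A' (g (A q))) {η₀ MA σ ε ν Gg MA' L' r : ℝ} (hr : 0 < r)
    (hq : r / 4 ≤ ‖q.2‖)
    (hη₀ : ‖(fderiv ℝ A' (A q) (fderiv ℝ A q (0, q.2))).2 - ((A' (A q)).2 - c)‖ ≤ η₀ * ‖q.2‖)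
    (hMA : ‖fderiv ℝ A q (0, q.2)‖ ≤ MA * ‖q.2‖) (hσ : |(fderiv ℝ A q (0, q.2)).2| ≤ σ)
    (hε0 : 0 ≤ ε) (hν0 : 0 ≤ ν) (hL'0 : 0 ≤ L') (hMA'0 : 0 ≤ MA') (hσ0 : 0 ≤ σ)
    (hgface : ∀ v : E', ‖fderiv ℝ g (A q) (v, 0) - (v, 0)‖ ≤ ε * ‖v‖)
    (hgnormal : ‖fderiv ℝ g (A q) (0, 1) - (0, 1)‖ ≤ ν) (hGg : ‖fderiv ℝ g (A q)‖ ≤ Gg)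
    (hMA' : ‖fderiv ℝ A' (A q)‖ ≤ MA')
    (hL' : ‖fderiv ℝ A' (g (A q)) - fderiv ℝ A' (A q)‖ ≤ L' * ε)
    (hΔ : ‖A' (g (A q)) - A' (A q)‖ ≤ MA' * ε) :
    ‖fderiv ℝ N q (0, q.2) - N q‖ ≤
      (η₀ + L' * ε * Gg * MA + MA' * ε * MA + 4 / r * (MA' * ν * σ + MA' * ε)) * ‖q.2‖ := by
  have h := norm_fderiv_band_sub_le hNev hA hg hA' hη₀ hMA hσ hε0 hν0 hL'0 hMA'0 hgface hgnormal
    hGg hMA' hL' hΔ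
  have hy : 1 ≤ 4 / r * ‖q.2‖ := by
    rw [div_mul_eq_mul_div, le_div_iff₀ hr]; linarith
  have hconst : MA' * ν * σ + MA' * ε ≤ (4 / r * (MA' * ν * σ + MA' * ε)) * ‖q.2‖ := by
    have h0 : 0 ≤ MA' * ν * σ + MA' * ε := by positivity
    calc MA' * ν * σ + MA' * ε = (MA' * ν * σ + MA' * ε) * 1 := by ring
      _ ≤ (MA' * ν * σ + MA' * ε) * (4 / r * ‖q.2‖) := by gcongr
      _ = (4 / r * (MA' * ν * σ + MA' * ε)) * ‖q.2‖ := by ring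
  calc ‖fderiv ℝ N q (0, q.2) - N q‖
      ≤ η₀ * ‖q.2‖ + (L' * ε * Gg * (MA * ‖q.2‖) + MA' * (ε * (MA * ‖q.2‖) + ν * σ) + MA' * ε) := h
    _ = (η₀ + L' * ε * Gg * MA + MA' * ε * MA) * ‖q.2‖ + (MA' * ν * σ + MA' * ε) := by ring
    _ ≤ (η₀ + L' * ε * Gg * MA + MA' * ε * MA) * ‖q.2‖ +
          (4 / r * (MA' * ν * σ + MA' * ε)) * ‖q.2‖ := by gcongr
    _ = (η₀ + L' * ε * Gg * MA + MA' * ε * MA + 4 / r * (MA' * ν * σ + MA' * ε)) * ‖q.2‖ := by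
          ring

end Literature.Topology.FourManifolds
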